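import Literature.Analysis.Fourier.SelbergMajorantsFourier
import Literature.NumberTheory.LFunctions.WeilMellinInversion
import HarnessLib

/-!
# Band-limited window tests whose transforms are Selberg's functions (`stub_selbergTests`)

Stub `stub_selbergTests` of the line `defect-compactness-design` (wave 2: structure of witnesses)
for the crux `WindowTraceArch` (stmt-RiemannHypothesis-11195; skeleton
`Summit.RiemannHypothesis.RiemannHypothesis.Cruxes.WindowTraceArch.DefectCompactnessDesign`).

**Statement.** For every `T ≥ 0` there are continuous functions `g± : ℝ → ℂ` with
`tsupport g± ⊆ [-log 2, log 2]` such that, for ALL complex `z`,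
`weilMellin g± (1/2 + z I) = F±(z)`, where `F₊ = selbergMajorant Δ 0 T` and
`F₋ = selbergMinorant Δ 0 T` are Selberg's majorant / minorant of `𝟙_{[0, T]}` with bandwidth
`Δ = (log 2) / (2π)`, and moreover `g±(0) = (T ± 2π / log 2) / (2π)`.

**Proof sketch.** Put `Φ = F±` (entire, integrable on `ℝ`, with Mathlib Fourier transform
`𝓕(Φ|_ℝ)` vanishing off `[-Δ, Δ]`: `fourier_selbergMajorant_eq_zero`,
`fourier_selbergMinorant_eq_zero`) and `g(x) := (1 / 2π) · 𝓕(Φ|_ℝ)(x / 2π)`.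
* `g` is continuous (`𝓕` of an integrable function is continuous) and vanishes for
  `|x| > 2πΔ = log 2`, so `tsupport g ⊆ [-log 2, log 2]` (the interval is closed).
* `𝓕(Φ|_ℝ)` is continuous with compact support, hence integrable, so Fourier inversion
  (`Continuous.fourierInv_fourier_eq`) gives `𝓕⁻ (𝓕 Φ|_ℝ) = Φ|_ℝ`; and for real `u`,
  `weilMellin g (1/2 + iu) = ∫ g(t) e^{iut} dt = ∫ 𝓕Φ(s) e^{2πius} ds = 𝓕⁻(𝓕Φ)(u) = Φ(u)`
  (substitution `t = 2πs`, `Measure.integral_comp_div`).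
* Both `z ↦ weilMellin g (1/2 + z I)` (`differentiable_weilMellin`) and `Φ` are entire and agree
  on `ℝ ∋ 1/(n+1) → 0`, hence everywhere (`AnalyticOnNhd.eq_of_frequently_eq`).
* `g(0) = (1 / 2π) 𝓕Φ(0) = (1 / 2π)((T - 0) ± 1/Δ)` (`fourier_selbergMajorant_zero`,
  `fourier_selbergMinorant_zero`) and `1/Δ = 2π / log 2`.

**Sources.** A. Selberg's functions as in J. D. Vaaler, *Some extremal functions in Fourier
analysis*, Bull. AMS 12 (1985), Thm. 8 (tree: `Literature/Analysis/Fourier/SelbergMajorants.lean`,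
`SelbergMajorantsFourier.lean`); Fourier inversion and the identity theorem from Mathlib. All
ingredients are proved tree / Mathlib facts. [folklore]
-/

set_option linter.dupNamespace false

noncomputable section

open Complex Filter Set MeasureTheory
open scoped Real Topology FourierTransform

namespace Summit.RiemannHypothesis.RiemannHypothesis.Theorems.SpectralTraceWindowTraceArch

open Literature.NumberTheory.LFunctions Literature.Analysis.Fourier

/-! ## The transform lemma: from a band-limited entire `Φ` to a window test `g` -/

/-- **From a band-limited entire function to a window test.** Let `Φ : ℂ → ℂ` be entire, with
`Φ|_ℝ` integrable and `𝓕(Φ|_ℝ)(ξ) = 0` for `|ξ| ≥ Δ` (`Δ > 0`). Then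
`g(x) := (1 / 2π) 𝓕(Φ|_ℝ)(x / 2π)` is continuous, `tsupport g ⊆ [-2πΔ, 2πΔ]`,
`weilMellin g (1/2 + z I) = Φ(z)` for every complex `z`, and `g(0) = (1 / 2π) 𝓕(Φ|_ℝ)(0)`.
[folklore] -/
theorem stub_selbergTests_transform {Φ : ℂ → ℂ} {Δ : ℝ} (hΔ : 0 < Δ)
    (hΦd : Differentiable ℂ Φ) (hΦi : Integrable fun v : ℝ => Φ v)
    (hΦz : ∀ ξ : ℝ, Δ ≤ |ξ| → 𝓕 (fun v : ℝ => Φ v) ξ = 0) :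
    ∃ g : ℝ → ℂ, Continuous g ∧ tsupport g ⊆ Icc (-(2 * π * Δ)) (2 * π * Δ) ∧
      (∀ z : ℂ, weilMellin g (1 / 2 + z * I) = Φ z) ∧
      g 0 = ((1 / (2 * π) : ℝ) : ℂ) * 𝓕 (fun v : ℝ => Φ v) 0 := by
  set Ψ : ℝ → ℂ := 𝓕 (fun v : ℝ => Φ v) with hΨ
  -- `Ψ` is continuous, compactly supported, integrable
  have hΨc : Continuous Ψ :=
    VectorFourier.fourierIntegral_continuous Real.continuous_fourierChar continuous_inner hΦi
  have hΨ0 : ∀ ξ : ℝ, ξ ∉ Icc (-Δ) Δ → Ψ ξ = 0 := by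
    intro ξ hξ
    apply hΦz
    rw [mem_Icc, not_and_or, not_le, not_le] at hξ
    rcases hξ with h | h
    · rw [abs_of_neg (by linarith)]; linarith
    · rw [abs_of_pos (by linarith)]; linarith
  have hΨK : HasCompactSupport Ψ := HasCompactSupport.intro isCompact_Icc hΨ0
  have hΨi : Integrable Ψ := hΨc.integrable_of_hasCompactSupport hΨK
  have hΦc : Continuous fun v : ℝ => Φ v := hΦd.continuous.comp continuous_ofReal
  have hinv : 𝓕⁻ Ψ = fun v : ℝ => Φ v := hΦc.fourierInv_fourier_eq hΦi hΨi
  have h2π : (0 : ℝ) < 2 * π := by positivity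
  -- the test function
  set g : ℝ → ℂ := fun x => ((1 / (2 * π) : ℝ) : ℂ) * Ψ (x / (2 * π)) with hg
  have hgc : Continuous g := continuous_const.mul (hΨc.comp (continuous_id.div_const _))
  have hg0 : ∀ x : ℝ, x ∉ Icc (-(2 * π * Δ)) (2 * π * Δ) → g x = 0 := by
    intro x hx
    have hx' : x / (2 * π) ∉ Icc (-Δ) Δ := by
      intro hmem
      apply hx
      rw [mem_Icc] at hmem ⊢
      rw [le_div_iff₀ h2π, div_le_iff₀ h2π] at hmem
      constructor <;> nlinarith [hmem.1, hmem.2]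
    simp only [hg, hΨ0 _ hx', mul_zero]
  have hgK : HasCompactSupport g := HasCompactSupport.intro isCompact_Icc hg0
  have hgsupp : tsupport g ⊆ Icc (-(2 * π * Δ)) (2 * π * Δ) :=
    closure_minimal (fun x hx => by_contra fun h => hx (hg0 x h)) isClosed_Icc
  -- the identity on the real line, by Fourier inversion
  have hreal : ∀ u : ℝ, weilMellin g (1 / 2 + (u : ℂ) * I) = Φ u := by
    intro u
    have h1 : Φ u = 𝓕⁻ Ψ u := by rw [hinv]
    rw [h1, Real.fourierInv_eq_fourier_neg, Real.fourier_real_eq_integral_exp_smul]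
    unfold weilMellin
    have h2 : ∀ t : ℝ, g t * cexp ((1 / 2 + (u : ℂ) * I - 1 / 2) * (t : ℂ)) =
        ((1 / (2 * π) : ℝ) : ℂ) *
          (fun v : ℝ => cexp (↑(-2 * π * v * -u) * I) • Ψ v) (t / (2 * π)) := by
      intro t
      have h3 : -2 * π * (t / (2 * π)) * -u = u * t := by field_simp
      simp only [hg, smul_eq_mul, h3]
      push_cast
      ring_nf
    simp_rw [h2]
    rw [MeasureTheory.integral_const_mul,
      Measure.integral_comp_div (fun v : ℝ => cexp (↑(-2 * π * v * -u) * I) • Ψ v) (2 * π),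
      abs_of_pos h2π, Complex.real_smul, ← mul_assoc, ← Complex.ofReal_mul,
      one_div_mul_cancel h2π.ne', Complex.ofReal_one, one_mul]
  -- extension to `ℂ` by the identity theorem
  have hgd : Differentiable ℂ fun z : ℂ => weilMellin g (1 / 2 + z * I) :=
    (differentiable_weilMellin hgc hgK).comp
      ((differentiable_const _).add (differentiable_id.mul_const _))
  have hall : (fun z : ℂ => weilMellin g (1 / 2 + z * I)) = Φ := by
    refine AnalyticOnNhd.eq_of_frequently_eq (z₀ := 0) (fun z _ => hgd.analyticAt z)
      (fun z _ => hΦd.analyticAt z) ?_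
    have hten : Tendsto (fun n : ℕ => (((1 / ((n : ℝ) + 1) : ℝ)) : ℂ)) atTop (𝓝[≠] 0) := by
      refine tendsto_nhdsWithin_iff.2 ⟨?_, Eventually.of_forall fun n => ?_⟩
      · have h := (Complex.continuous_ofReal.tendsto 0).comp
          tendsto_one_div_add_atTop_nhds_zero_nat
        rw [Complex.ofReal_zero] at h
        exact h
      · rw [mem_compl_iff, mem_singleton_iff, Complex.ofReal_eq_zero]
        positivity
    exact hten.frequently (Frequently.of_forall fun n => hreal _)
  refine ⟨g, hgc, hgsupp, fun z => congrFun hall z, ?_⟩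
  simp [hg]

/-! ## The registered stub -/

/-- **stub_selbergTests — the band-limited window tests with transforms `F±`.** For `T ≥ 0` there
are continuous `g±` supported in the closed window `[-log 2, log 2]` with
`weilMellin g± (1/2 + z I) = F±(z)` for ALL complex `z`, where
`F± = selbergMajorant/selbergMinorant Δ 0 T`, `Δ = (log 2)/2π`, and `g±(0) = (T ± 2π/log 2)/2π`.
Construction: `g±(x) := (1/2π) 𝓕(F±|_ℝ)(x/2π)`; support from `fourier_selbergMajorant_eq_zero`
(`𝓕F± = 0` off `[-Δ, Δ]`, and `2πΔ = log 2`), the transform identity by Fourier inversion and the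
identity theorem (`stub_selbergTests_transform`), and `g±(0) = (1/2π) 𝓕F±(0)` by
`fourier_selbergMajorant_zero` / `fourier_selbergMinorant_zero`. [folklore] -/
theorem stub_selbergTests :
    ∀ T : ℝ, 0 ≤ T → ∃ gp gm : ℝ → ℂ, Continuous gp ∧ Continuous gm ∧
      tsupport gp ⊆ Set.Icc (-Real.log 2) (Real.log 2) ∧ tsupport gm ⊆ Set.Icc (-Real.log 2) (Real.log 2) ∧
      (∀ z : ℂ, Literature.NumberTheory.LFunctions.weilMellin gp (1 / 2 + z * Complex.I) =
        Literature.Analysis.Fourier.selbergMajorant (Real.log 2 / (2 * Real.pi)) 0 T z) ∧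
      (∀ z : ℂ, Literature.NumberTheory.LFunctions.weilMellin gm (1 / 2 + z * Complex.I) =
        Literature.Analysis.Fourier.selbergMinorant (Real.log 2 / (2 * Real.pi)) 0 T z) ∧
      gp 0 = (((T + 2 * Real.pi / Real.log 2) / (2 * Real.pi) : ℝ) : ℂ) ∧
      gm 0 = (((T - 2 * Real.pi / Real.log 2) / (2 * Real.pi) : ℝ) : ℂ) := by
  intro T hT
  have hlog : 0 < Real.log 2 := Real.log_pos one_lt_two
  have hπ : 0 < π := Real.pi_pos
  have hΔ : 0 < Real.log 2 / (2 * π) := by positivity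
  have hwin : 2 * π * (Real.log 2 / (2 * π)) = Real.log 2 := by field_simp
  obtain ⟨gp, hgpc, hgps, hgpM, hgp0⟩ := stub_selbergTests_transform hΔ
    (differentiable_selbergMajorant _ 0 T) (integrable_selbergMajorant_ofReal hΔ hT)
    (fun ξ hξ => fourier_selbergMajorant_eq_zero hΔ hT hξ)
  obtain ⟨gm, hgmc, hgms, hgmM, hgm0⟩ := stub_selbergTests_transform hΔ
    (differentiable_selbergMinorant _ 0 T) (integrable_selbergMinorant_ofReal hΔ hT)
    (fun ξ hξ => fourier_selbergMinorant_eq_zero hΔ hT hξ)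
  rw [hwin] at hgps hgms
  refine ⟨gp, gm, hgpc, hgmc, hgps, hgms, hgpM, hgmM, ?_, ?_⟩
  · rw [hgp0, fourier_selbergMajorant_zero hΔ hT]
    push_cast
    field_simp
    ring
  · rw [hgm0, fourier_selbergMinorant_zero hΔ hT]
    push_cast
    field_simp
    ring

end Summit.RiemannHypothesis.RiemannHypothesis.Theorems.SpectralTraceWindowTraceArch

end
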